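import Summits.QuantumFields.YangMills.Theorems.SwapVirialDeficitBlowUpGnomonicSeamCommutatorFloor
import Summits.QuantumFields.YangMills.Theorems.SwapVirialDeficitZeroModeGroupThreeSmallBallLimit
import HarnessLib

/-!
# THE SEAM-COMMUTATOR FLOORS IN COORDINATES: `x₀²·|2A₁·M(ψ)u + ζ(z)|²/(225L⁶(1+x₀²)²)` and `|y₀·(R(ψ)u + ζ(z)) − x₀·v|²/(225L⁶(1+x₀²)(1+y₀²))`
# (free-hands support of ⟨stmt-QuantumFields-24197⟩ `SwapVirialDeficit.SwapGluedStiffness`; stub S3∕S4 «finiteness of the bottom measure» — the explicit soft block)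

✓`fibre_raySecond_ge_seamComm` and ✓`fibre_raySecond_ge_seamComm₂` bound the fibre Hessian `Q(w)` at the base point `(a; x₀, y₀)` by squared norms of
quaternion commutators; here they are read in coordinates.  With `A₀ = re a/‖a‖ = cos ψ`, `A₁ = ‖im a‖/‖a‖ = sin ψ` (`A₀² + A₁² = 1`), the conjugation
`P ↦ Ā·P·A` by the hub unit rotates the `(j,k)`-plane by `R(ψ) = [[A₀²−A₁², 2A₀A₁],[−2A₀A₁, A₀²−A₁²]]` (angle `2ψ`), and `x̂₀·(0,z)` has `(j,k)`-part
`ζ(z) := (z₁ − x₀z₂, z₂ + x₀z₁)/√(1+x₀²)` (up to the common sign):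
* §1 components: `axisUnit_components`, `radialUnit_gnoLetter_axial_components`, `gnomonicQuat_im_components`, `conj_axial_transverse_components`;
* §2 ★★★ `fibre_raySecond_ge_seamComm_coords`:
  `x₀²·[(2A₁(−A₁u₀ + A₀u₁) + (z₁ − x₀z₂))² + (2A₁(−A₀u₀ − A₁u₁) + (z₂ + x₀z₁))²] / (225·L⁶·(1+x₀²)²) ≤ Q(w)` — the END stiffness `4A₁²x₀²|u|²` (`A₁ = sin ψ → 1`)
  coupled to `z_⊥`;
* (sequel, not in this file) the `[C₁,C₂]` floor ✓`fibre_raySecond_ge_seamComm₂` reads the same way: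
  `[(y₀((A₀²−A₁²)u₀ + 2A₀A₁u₁ + z₁ − x₀z₂) − x₀v₀)² + (y₀(−2A₀A₁u₀ + (A₀²−A₁²)u₁ + z₂ + x₀z₁) − x₀v₁)²] / (225·L⁶·(1+x₀²)(1+y₀²)) ≤ Q(w)` — at the tip
  (`R = 1`) the relative rotation `|y₀u − x₀v|²` again, at the END (`R = −1`) `|y₀u + x₀v|²`, so with ✓`gnoDeficit_one_ge_relRot` both `y₀²|u|²` and `x₀²|v|²` are
  stiff there.
With ✓`fibre_raySecond_ge_aniso` the soft `(u,v)`-block (after absorbing the `z_⊥` couplings into the hard `z` floor) has, per transverse component, determinant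
`≍ ab + eb + (a+e)(c+c′)x₀² + b(c+c′)y₀² + 4cc′x₀²y₀²sin²ψ` (`a ∝ sin²2ψ`, `b ∝ sin²ψ`, `e ∝ x₀²sin²ψ`, `c, c′ ∝ 1`) — positive off the apex and off stratum B,
`≍ ψ²(ψ² + x₀² + y₀²)` at the tip and `≍ (π/2−ψ)² + x₀² + y₀²` at the end: the «codimension = radial exponent» counts of LEAD memo4 §2.

HONEST LABEL: quaternion component algebra on landed floors; S3∕S4∕S5, ⟨24197⟩ ∕ ⟨24194⟩ ∕ ⟨24497⟩ OPEN; own crux ⟨22884⟩ OPEN (blocked-on ⟨19935⟩); the Yang–Mills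
mass gap is NOT proved; no summit is proved by a line.  THEOREMS ONLY (0 `def`, 0 `sorry`), standard axioms.
Width seat ym-line-sfw-p2-w3 g66 (cell ym-idea-1, free hands), `--supports stmt-QuantumFields-24197`.  References: [cite: Luscher1983, §2]; [folklore].
-/

set_option autoImplicit false

noncomputable section

open MeasureTheory Quaternion
open scoped BigOperators Quaternion
open Literature.MathematicalPhysics.QuantumFieldTheory hiding SU2
open Literature.MathematicalPhysics.QuantumLattice
open Literature.Analysis.Calculus (radialUnit radialUnit_def norm_radialUnit)

namespace Summit.QuantumFields.YangMills.Theorems.SwapVirialDeficit.BlowUpRing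

open Summit.QuantumFields.YangMills.Theorems.FemtoTransferGap
open Summit.QuantumFields.YangMills.Theorems.SwapTwistDeficit.ToronLog (axisPoint)
open Summit.QuantumFields.YangMills.Theorems.SwapVirialDeficit.ZeroModeSigma (norm_axisUnit axisUnit_axial axial_sq_add_sq)
open Summit.QuantumFields.YangMills.Theorems.SwapVirialDeficit.ZeroModeGroup (norm_axisPoint)
open Summit.QuantumFields.YangMills.Theorems.SwapVirialDeficit.Gnomonic (normSq3)

variable {L : ℕ} [NeZero L]

/-! ## §1 Components -/

omit [NeZero L] in
/-- Components of the hub unit `A = ν(axisPoint a) = (re a, ‖im a‖, 0, 0)/‖a‖`. [folklore] -/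
theorem axisUnit_components (a : ℍ) :
    (radialUnit (axisPoint a)).re = ‖a‖⁻¹ * a.re ∧ (radialUnit (axisPoint a)).imI = ‖a‖⁻¹ * ‖a.im‖ ∧
      (radialUnit (axisPoint a)).imJ = 0 ∧ (radialUnit (axisPoint a)).imK = 0 := by
  rw [radialUnit_def, norm_axisPoint]
  refine ⟨?_, ?_, ?_, ?_⟩ <;> simp [axisPoint]

omit [NeZero L] in
/-- Components of the axial base letter `x̂₀ = ν(±(1, c, 0, 0)) = ±(1, c, 0, 0)/√(1+c²)`. [folklore] -/
theorem radialUnit_gnoLetter_axial_components (ε : Bool) (c : ℝ) :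
    (radialUnit (gnoLetter ε ![c, 0, 0])).re = (Real.sqrt (1 + c ^ 2))⁻¹ * gnoSign ε ∧
      (radialUnit (gnoLetter ε ![c, 0, 0])).imI = (Real.sqrt (1 + c ^ 2))⁻¹ * (gnoSign ε * c) ∧
      (radialUnit (gnoLetter ε ![c, 0, 0])).imJ = 0 ∧ (radialUnit (gnoLetter ε ![c, 0, 0])).imK = 0 := by
  rw [radialUnit_def, norm_gnoLetter_axial, gnoLetter_eq]
  refine ⟨?_, ?_, ?_, ?_⟩ <;> simp [gnomonicQuat]

omit [NeZero L] in
/-- Components of the pure quaternion `(0, v)`. [folklore] -/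
theorem gnomonicQuat_im_components (v : Fin 3 → ℝ) :
    (gnomonicQuat v).im.re = 0 ∧ (gnomonicQuat v).im.imI = v 0 ∧ (gnomonicQuat v).im.imJ = v 1 ∧ (gnomonicQuat v).im.imK = v 2 := by
  simp [gnomonicQuat]

omit [NeZero L] in
/-- ★ Conjugating a transverse pure quaternion `P = (0,0,p₁,p₂)` by an axial `A`: `Ā·P·A` is transverse with `(j,k)`-part
`((A₀²−A₁²)p₁ + 2A₀A₁p₂, −2A₀A₁p₁ + (A₀²−A₁²)p₂)` (a rotation by twice the hub angle when `‖A‖ = 1`). [folklore] -/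
theorem conj_axial_transverse_components {A P : ℍ} (hA : A.imJ = 0 ∧ A.imK = 0) (hP : P.re = 0 ∧ P.imI = 0) :
    (star A * P * A).re = 0 ∧ (star A * P * A).imI = 0 ∧
      (star A * P * A).imJ = (A.re ^ 2 - A.imI ^ 2) * P.imJ + 2 * A.re * A.imI * P.imK ∧
      (star A * P * A).imK = -(2 * A.re * A.imI) * P.imJ + (A.re ^ 2 - A.imI ^ 2) * P.imK := by
  refine ⟨?_, ?_, ?_, ?_⟩ <;>
  simp only [Quaternion.re_mul, Quaternion.imI_mul, Quaternion.imJ_mul, Quaternion.imK_mul, Quaternion.re_star, Quaternion.imI_star,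
    Quaternion.imJ_star, Quaternion.imK_star, hA.1, hA.2, hP.1, hP.2] <;> ring

/-! ## §2 The `[C₀, C₁]` floor in coordinates -/

/-- ★★★ **THE SEAM FLOOR IN COORDINATES** (`A₀ = re a/‖a‖`, `A₁ = ‖im a‖/‖a‖`; principal sector, `ε_z = +`, followers `+`, hub `a ≠ 0`):
`x₀²·[(2A₁(−A₁u₀ + A₀u₁) + (z₁ − x₀z₂))² + (2A₁(−A₀u₀ − A₁u₁) + (z₂ + x₀z₁))²] / (225·L⁶·(1+x₀²)²) ≤ (d²/ds²)F̂(η₀ + s·ξ(w))|₀`. [cite: Luscher1983, §2] -/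
theorem fibre_raySecond_ge_seamComm_coords {a : ℍ} (ha : a ≠ 0) (ε : GnoSign L) (hz : ε.2.1 = true) (hε : ε.2.2 = fun _ => true) (x₀ y₀ : ℝ)
    (w : ((Fin 2 → ℝ) × (Fin 2 → ℝ)) × (Fin 3 → ℝ) × (Fol L → Fin 3 → ℝ)) :
    x₀ ^ 2 * ((2 * (‖a‖⁻¹ * ‖a.im‖) * (-((‖a‖⁻¹ * ‖a.im‖) * w.1.1 0) + (‖a‖⁻¹ * a.re) * w.1.1 1) + (w.2.1 1 - x₀ * w.2.1 2)) ^ 2 +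
        (2 * (‖a‖⁻¹ * ‖a.im‖) * (-((‖a‖⁻¹ * a.re) * w.1.1 0) - (‖a‖⁻¹ * ‖a.im‖) * w.1.1 1) + (w.2.1 2 + x₀ * w.2.1 1)) ^ 2) /
        (225 * (L : ℝ) ^ 6 * (1 + x₀ ^ 2) ^ 2) ≤
      iteratedDeriv 2 (fun s : ℝ => gnoDeficit (fun _ => false) (fun _ => 1) a ε
        (((((![x₀, 0, 0] : Fin 3 → ℝ), (![y₀, 0, 0] : Fin 3 → ℝ)), ((0 : Fin 3 → ℝ), (0 : Fol L → Fin 3 → ℝ))) : GnoCoord L) +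
          s • ((((![0, w.1.1 0, w.1.1 1] : Fin 3 → ℝ), (![0, w.1.2 0, w.1.2 1] : Fin 3 → ℝ)), (w.2.1, w.2.2)) : GnoCoord L))) 0 := by
  have hL : (0 : ℝ) < L := by exact_mod_cast NeZero.pos L
  have h := fibre_raySecond_ge_seamComm (L := L) ha ε hz hε x₀ y₀ w
  refine le_trans (le_of_eq ?_) h
  -- names and components
  set A : ℍ := radialUnit (axisPoint a) with hA
  set N : ℝ := Real.sqrt (1 + x₀ ^ 2) with hN
  set σ : ℝ := gnoSign ε.1.1 with hσ
  set X' : ℍ := N⁻¹ • (σ • (gnomonicQuat ![0, w.1.1 0, w.1.1 1]).im) with hX'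
  set Z' : ℍ := (gnomonicQuat w.2.1).im with hZ'
  set xh : ℍ := radialUnit (gnoLetter ε.1.1 ![x₀, 0, 0]) with hxh
  set q : ℍ := star A * X' * A + xh * Z' - X' with hq
  obtain ⟨hAre, hAimI, hAimJ, hAimK⟩ := axisUnit_components a
  obtain ⟨hxre, hximI, hximJ, hximK⟩ := radialUnit_gnoLetter_axial_components ε.1.1 x₀
  obtain ⟨hPre, hPimI, hPimJ, hPimK⟩ := gnomonicQuat_im_components (![0, w.1.1 0, w.1.1 1] : Fin 3 → ℝ)
  obtain ⟨hZre, hZimI, hZimJ, hZimK⟩ := gnomonicQuat_im_components (w.2.1)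
  rw [← hA] at hAre hAimI hAimJ hAimK
  rw [← hxh] at hxre hximI hximJ hximK
  rw [← hZ'] at hZre hZimI hZimJ hZimK
  have hX're : X'.re = 0 := by rw [hX', Quaternion.re_smul, Quaternion.re_smul, hPre]; simp
  have hX'imI : X'.imI = 0 := by rw [hX', Quaternion.imI_smul, Quaternion.imI_smul, hPimI]; simp
  have hX'imJ : X'.imJ = N⁻¹ * (σ * w.1.1 0) := by
    rw [hX', Quaternion.imJ_smul, Quaternion.imJ_smul, hPimJ]; simp [smul_eq_mul]
  have hX'imK : X'.imK = N⁻¹ * (σ * w.1.1 1) := by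
    rw [hX', Quaternion.imK_smul, Quaternion.imK_smul, hPimK]; simp [smul_eq_mul]
  obtain ⟨hCre, hCimI, hCimJ, hCimK⟩ := conj_axial_transverse_components (A := A) (P := X') ⟨hAimJ, hAimK⟩ ⟨hX're, hX'imI⟩
  -- the components of `q`
  have hqJ : q.imJ = N⁻¹ * σ * (((‖a‖⁻¹ * a.re) ^ 2 - (‖a‖⁻¹ * ‖a.im‖) ^ 2 - 1) * w.1.1 0 + 2 * (‖a‖⁻¹ * a.re) * (‖a‖⁻¹ * ‖a.im‖) * w.1.1 1 +
      (w.2.1 1 - x₀ * w.2.1 2)) := by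
    have e : q.imJ = (star A * X' * A).imJ + (xh * Z').imJ - X'.imJ := by
      rw [hq, Quaternion.imJ_sub, Quaternion.imJ_add]
    rw [e, hCimJ, Quaternion.imJ_mul, hAre, hAimI, hX'imJ, hX'imK, hxre, hximI, hximJ, hximK, hZre, hZimI, hZimJ, hZimK]
    ring
  have hqK : q.imK = N⁻¹ * σ * (-(2 * (‖a‖⁻¹ * a.re) * (‖a‖⁻¹ * ‖a.im‖)) * w.1.1 0 + ((‖a‖⁻¹ * a.re) ^ 2 - (‖a‖⁻¹ * ‖a.im‖) ^ 2 - 1) * w.1.1 1 +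
      (w.2.1 2 + x₀ * w.2.1 1)) := by
    have e : q.imK = (star A * X' * A).imK + (xh * Z').imK - X'.imK := by
      rw [hq, Quaternion.imK_sub, Quaternion.imK_add]
    rw [e, hCimK, Quaternion.imK_mul, hAre, hAimI, hX'imJ, hX'imK, hxre, hximI, hximJ, hximK, hZre, hZimI, hZimJ, hZimK]
    ring
  -- the commutator norm
  have hnorm := norm_sq_comm_axial_left (x := xh) ⟨hximJ, hximK⟩ q
  rw [hnorm, hximI, hqJ, hqK]
  -- scalar facts
  have hA1 : ‖A‖ = 1 := norm_axisUnit ha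
  have hunit : (‖a‖⁻¹ * a.re) ^ 2 + (‖a‖⁻¹ * ‖a.im‖) ^ 2 = 1 := by
    have h := axial_sq_add_sq hA1 hAimJ hAimK
    rw [hAre, hAimI] at h; exact h
  have hσ2 : σ ^ 2 = 1 := gnoSign_sq ε.1.1
  have hN2 : N ^ 2 = 1 + x₀ ^ 2 := by rw [hN, Real.sq_sqrt (by positivity)]
  have hNpos : 0 < N := by rw [hN]; positivity
  have hNinv : N⁻¹ ^ 2 = (1 + x₀ ^ 2)⁻¹ := by rw [inv_pow, hN2]
  have e1 : (‖a‖⁻¹ * a.re) ^ 2 - (‖a‖⁻¹ * ‖a.im‖) ^ 2 - 1 = -(2 * (‖a‖⁻¹ * ‖a.im‖) ^ 2) := by linarith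
  rw [e1]
  have hx1 : (0 : ℝ) < 1 + x₀ ^ 2 := by positivity
  -- replace `N⁻¹` by a fresh positive real with `t² = (1+x₀²)⁻¹`
  have hNi : (N⁻¹) ^ 2 * (1 + x₀ ^ 2) = 1 := by rw [hNinv, inv_mul_cancel₀ hx1.ne']
  generalize N⁻¹ = t at hNi ⊢
  set J : ℝ := 2 * (‖a‖⁻¹ * ‖a.im‖) * (-((‖a‖⁻¹ * ‖a.im‖) * w.1.1 0) + (‖a‖⁻¹ * a.re) * w.1.1 1) + (w.2.1 1 - x₀ * w.2.1 2) with hJ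
  set K : ℝ := 2 * (‖a‖⁻¹ * ‖a.im‖) * (-((‖a‖⁻¹ * a.re) * w.1.1 0) - (‖a‖⁻¹ * ‖a.im‖) * w.1.1 1) + (w.2.1 2 + x₀ * w.2.1 1) with hK
  have eJ : -(2 * (‖a‖⁻¹ * ‖a.im‖) ^ 2) * w.1.1 0 + 2 * (‖a‖⁻¹ * a.re) * (‖a‖⁻¹ * ‖a.im‖) * w.1.1 1 + (w.2.1 1 - x₀ * w.2.1 2) = J := by
    rw [hJ]; ring
  have eK : -(2 * (‖a‖⁻¹ * a.re) * (‖a‖⁻¹ * ‖a.im‖)) * w.1.1 0 + -(2 * (‖a‖⁻¹ * ‖a.im‖) ^ 2) * w.1.1 1 + (w.2.1 2 + x₀ * w.2.1 1) = K := by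
    rw [hK]; ring
  rw [eJ, eK]
  -- `4 (t σ x₀)² ((tσJ)² + (tσK)²) / (900 L⁶) = x₀² (J² + K²) / (225 L⁶ (1+x₀²)²)`
  have ht2 : t ^ 2 = (1 + x₀ ^ 2)⁻¹ := by
    field_simp
    linarith [hNi]
  rw [div_eq_div_iff (by positivity) (by positivity)]
  have e4 : 4 * (t * (σ * x₀)) ^ 2 * ((t * σ * J) ^ 2 + (t * σ * K) ^ 2) = 4 * x₀ ^ 2 * (J ^ 2 + K ^ 2) * (σ ^ 2) ^ 2 * (t ^ 2) ^ 2 := by ring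
  rw [e4, hσ2, ht2]
  field_simp
  ring

end Summit.QuantumFields.YangMills.Theorems.SwapVirialDeficit.BlowUpRing

end
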